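import Summits.BirchSwinnertonDyer.Rank1Residual.ManinAdditive.TwistOrbitIsogenyDegree
import HarnessLib
import HarnessLib.Audit.Tags

/-!
# §26 imc's landed leaf E-imc-3b `RamifiedTwistOptimalityCommutes p` PROVED at every `p`, unconditionally
# (`ramifiedTwistOptimalityCommutes_holds`) — cell `bsd-f2-manin`

Cell `bsd-f2-manin` (D-0131 (3) frontier: the Manin constant at additive primes), analytic lens
(planner `bsd-f2-manin-an` g5), typed VERBATIM by the cell typer from HOME `run/shared/lean/pub/bsd-f2-manin/an/Sec24Core-g5.lean` sha16 9ed34f9b51be5933 (1181 lines, §24–§26 of the cumulative HOME `an/Sketch-an6.lean` bd37945ff22921ca over TREE imports only; farm rc 0 · 0 errors · 0 warnings · 0 sorries; MEMO-an §41–§43; CANDIDATES rows E-an-26…31), split into four chained theorem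
files `TwistOrbitIndexEngine` (§24 core) ← `TwistOrbitIndexEngineOdd` (§24 instances at `d = q*` and the
edge E-imc-2 ⇒ E-imc-7R) ← `TwistOrbitIsogenyDegree` (§25) ← `RamifiedTwistOptimalityCommutesProof` (§26,
the closer of imc's landed leaf E-imc-3b), plus the conjecture-only leaf `CommutingOrbitManinValEq.lean`
(E-an-28's open target). Nothing conjectural is asserted: every open law enters as an explicit hypothesis;
the `@[conjecture]` obligations declared in these files come with their kernel-checked `_holds`.

THIS FILE (source lines 1079–1176): by §25 a flip makes every `ℚ`-isogeny `T = W ⊗ p* → W′` have degree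
`p·k²`; a minimal-degree one then does not kill `T[p]` (*AEC* III.4.11), so `ker ∩ T[p]` is a rational
`p`-line and `W[p]` is reducible. Contrapositive: `W[p]` irreducible ⇒ optimality COMMUTES with the
`χ_{p*}`-twist — this is `theorem ramifiedTwistOptimalityCommutes_holds (p : ℕ) : RamifiedTwistOptimalityCommutes p`,
closing the `@[conjecture]` leaf `RamifiedTwistOptimalityCommutes.lean` (E-imc-3b, IMC-A v2; REF1 SURVIVES,
refuter-2: NOT in print — asserted implicitly, and falsely without irreducibility, in Edixhoven 1991 §4) with
no Mazur–Kenku, no CM proviso and no minimality. Beyond-print theorem: YES (the cell's record). Corollary: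
on the irreducible locus E-imc-2 reduces to `CommutingOrbitManinValEq p`.
-/

noncomputable section

open scoped MatrixGroups ModularForm

open CongruenceSubgroup WeierstrassCurve
  Literature.NumberTheory.DiophantineGeometry
  Literature.NumberTheory.EllipticCurves
  Literature.NumberTheory.EllipticCurves.ModularForms

namespace Summit.BirchSwinnertonDyer.Rank1Residual.ManinAdditive

section CovolumeEngine

open scoped Pointwise

/-! ## §26 E-imc-3b `RamifiedTwistOptimalityCommutes p` PROVED AT EVERY ODD `p`, UNCONDITIONALLY:
## irreducible `W[p]` ⇒ NO FLIP ⇒ the optimal curve of the `p*`-twisted class IS `u • (W ⊗ p*)`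

The isogeny-degree reading of §25 makes imc's landed leaf E-imc-3b (IMC-A v2, `RamifiedTwistOptimalityCommutes`,
«`E[p]` irreducible ⇒ optimality commutes with the `χ_{p*}`-twist», REF1 SURVIVES 0 violations, NOT in print) a
THEOREM with no Mazur–Kenku, no CM proviso, no non-isogeny proviso and no minimality: on a FLIP every `ℚ`-isogeny
`T = W ⊗ p* → W′` has degree `p·k²` (§25), so a `ℚ`-isogeny `φ : T → W′` of MINIMAL degree has `p ∣ deg φ` and
does not kill `T[p]` (else it factors through `[p]`, *AEC* III.4.11, contradicting minimality); hence
`ker φ ∩ T[p]` is a rational `p`-line (Galois-stable, order `p` by Cauchy and `T[p] ⊄ ker φ`), `T[p]` is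
reducible, and so is `W[p]` (`(W ⊗ p*) ⊗ p* ≅ W`, *AEC* X.5.4).  Contrapositive: `W[p]` irreducible ⇒ COMMUTES. -/

/-- If every `ℚ`-isogeny `T → W′` has degree divisible by the prime `p` (and one exists), then `T[p]` is
reducible: a minimal-degree isogeny does not kill `T[p]` (*AEC* III.4.11), so `ker ∩ T[p]` is a rational line.
[cite: SilvermanAEC2009, Cor. III.4.11, Thm. III.4.10] -/
theorem not_hasIrreducibleModPGaloisRep_of_forall_dvd_degree {T W' : WeierstrassCurve ℚ} [T.IsElliptic]
    [W'.IsElliptic] {p : ℕ} [Fact p.Prime] (hiso : IsIsogenous T W')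
    (h : ∀ φ : Isogeny T W', p ∣ φ.degree) : ¬ T.HasIrreducibleModPGaloisRep p := by
  classical
  obtain ⟨φ₀⟩ := hiso
  have hex : ∃ n, ∃ φ : Isogeny T W', φ.degree = n := ⟨_, φ₀, rfl⟩
  obtain ⟨φ, hφ⟩ := Nat.find_spec hex
  have hmin : ∀ ψ : Isogeny T W', φ.degree ≤ ψ.degree := fun ψ ↦ by
    rw [hφ]; exact Nat.find_min' hex ⟨ψ, rfl⟩
  have hp : p.Prime := Fact.out
  have hne : ∃ P : geomPoints T, P ∈ geomTorsion T (p : ℤ) ∧ φ P ≠ 0 := by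
    by_contra hcon
    push Not at hcon
    have hle : geomTorsion T (p : ℤ) ≤ φ.toAddMonoidHom.ker := fun P hP ↦ by
      rw [AddMonoidHom.mem_ker]; exact hcon P hP
    obtain ⟨lam, hlt, -, -⟩ :=
      φ.exists_degree_lt_of_geomTorsion_le_ker hp (by exact_mod_cast hp.ne_zero) hle
    exact absurd (hmin lam) (not_le.mpr hlt)
  exact Literature.NumberTheory.EllipticCurves.Rank1Residual.not_hasIrreducibleModPGaloisRep_of_isRationalLine
    (Summit.BirchSwinnertonDyer.Rank1Residual.GVPeriod.isRationalLine_ker_inf_torsion φ (h φ) hne)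

/-- Irreducibility of `E[p]` passes to a quadratic twist: `(W ⊗ d) ⊗ d = C • W` (*AEC* X.5 Cor. 5.4) and a
rational line pulls back along the twist isomorphism (tree `not_hasIrreducibleModPGaloisRep_twist`).
[cite: SilvermanAEC2009, X.5 Cor. 5.4] -/
theorem hasIrreducibleModPGaloisRep_quadraticTwist {W : WeierstrassCurve ℚ} [W.IsElliptic] {p : ℕ}
    [Fact p.Prime] (hirr : W.HasIrreducibleModPGaloisRep p) {d : ℚ} (hd : d ≠ 0)
    [(W.quadraticTwist d).IsElliptic] : (W.quadraticTwist d).HasIrreducibleModPGaloisRep p := by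
  by_contra hred
  obtain ⟨C, hC⟩ := W.exists_variableChange_smul_eq_quadraticTwist_sq hd
  have hC' : C • W = (W.quadraticTwist d).quadraticTwist d := by
    rw [quadraticTwist_quadraticTwist, ← sq]; exact hC
  exact Literature.NumberTheory.EllipticCurves.Rank1Residual.not_hasIrreducibleModPGaloisRep_twist
    hred hd W C hC' hirr

/-- **E-imc-3b at the odd prime `q`, orbit form (PROVED, unconditional):** `q² ∣ N`, both data lattice-optimal
at the common conductor, `W ⊗ q* ~ W′`, `W[q]` irreducible ⇒ `∃ u, u • (W ⊗ q*) = W′`.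
[cite: Watkins2002, §2.1 (shape only)] [cite: SilvermanAEC2009, Thm. VI.4.1(b), Cor. III.4.11, X.5 Cor. 5.4] -/
theorem pStar_optimal_orbit_commutes_of_irreducible {q : ℕ} (hq : q.Prime) (hq2 : q ≠ 2) :
    ∀ (W W' : WeierstrassCurve ℚ) [W.IsElliptic] [W'.IsElliptic] [NeZero (W.conductorNorm ℤ)]
      [NeZero (W'.conductorNorm ℤ)] (D : ModularParametrizationData W (W.conductorNorm ℤ))
      (D' : ModularParametrizationData W' (W'.conductorNorm ℤ)),
      IsLatticeOptimal D → IsLatticeOptimal D' →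
      q ^ 2 ∣ W.conductorNorm ℤ → W'.conductorNorm ℤ = W.conductorNorm ℤ →
      IsIsogenous (W.quadraticTwist ((((-1 : ℤ) ^ (q / 2) * q : ℤ)) : ℚ)) W' →
      W.HasIrreducibleModPGaloisRep q →
      ∃ u : VariableChange ℚ, u • W.quadraticTwist ((((-1 : ℤ) ^ (q / 2) * q : ℤ)) : ℚ) = W' := by
  intro W W' _ _ _ _ D D' hD hD' hM hN hiso hirr
  haveI : Fact q.Prime := ⟨hq⟩
  have hdZ : ((-1 : ℤ) ^ (q / 2) * q : ℤ) ≠ 0 :=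
    mul_ne_zero (pow_ne_zero _ (by norm_num)) (by exact_mod_cast hq.ne_zero)
  have hd0 : ((((-1 : ℤ) ^ (q / 2) * q : ℤ)) : ℚ) ≠ 0 := by exact_mod_cast hdZ
  haveI := W.isElliptic_quadraticTwist hd0
  by_contra hflip
  push Not at hflip
  have hdvd : ∀ φ : Isogeny (W.quadraticTwist ((((-1 : ℤ) ^ (q / 2) * q : ℤ)) : ℚ)) W', q ∣ φ.degree :=
    fun φ ↦ by
      obtain ⟨k, hk⟩ := pStar_optimal_flip_isogeny_degree hq hq2 D D' hD hD' hM hN hiso hflip φ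
      exact ⟨k ^ 2, hk⟩
  exact not_hasIrreducibleModPGaloisRep_of_forall_dvd_degree hiso hdvd
    (hasIrreducibleModPGaloisRep_quadraticTwist hirr hd0)

/-- **imc's landed leaf E-imc-3b `RamifiedTwistOptimalityCommutes p` (IMC-A v2) is a THEOREM at every `p`**
(its hypotheses `p ≠ 2`, minimality and `¬ (W ~ W′)` are carried, the last two unused). -/
theorem ramifiedTwistOptimalityCommutes_holds (p : ℕ) : RamifiedTwistOptimalityCommutes p := by
  intro W W' _ _ _ _ _ _ D D' hp hp2 hD hD' hM hN hiso hirr _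
  exact pStar_optimal_orbit_commutes_of_irreducible hp hp2 W W' D D' hD hD' hM hN hiso hirr

/-- **E-imc-1b for irreducible `W[p]` reduces to its commuting case** (no Mazur–Kenku): on orbits with `W[p]`
irreducible there are no flips, so `CommutingOrbitManinValEq p` gives `v_p(c′) = v_p(c)` there. -/
theorem maninValEq_of_commuting_of_irreducible {p : ℕ} (hp : p.Prime) (hp2 : p ≠ 2)
    (hV : CommutingOrbitManinValEq p) :
    ∀ (W W' : WeierstrassCurve ℚ) [W.IsElliptic] [W.IsGloballyMinimal] [W'.IsElliptic]
      [W'.IsGloballyMinimal] [NeZero (W.conductorNorm ℤ)] [NeZero (W'.conductorNorm ℤ)]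
      (D : ModularParametrizationData W (W.conductorNorm ℤ))
      (D' : ModularParametrizationData W' (W'.conductorNorm ℤ)),
      IsLatticeOptimal D → IsLatticeOptimal D' →
      p ^ 2 ∣ W.conductorNorm ℤ → W'.conductorNorm ℤ = W.conductorNorm ℤ →
      IsIsogenous (W.quadraticTwist ((((-1 : ℤ) ^ (p / 2) * p : ℤ)) : ℚ)) W' →
      W.HasIrreducibleModPGaloisRep p →
      padicValInt p D'.c = padicValInt p D.c := by
  intro W W' _ _ _ _ _ _ D D' hD hD' hM hN hiso hirr
  obtain ⟨u, hu⟩ := pStar_optimal_orbit_commutes_of_irreducible hp hp2 W W' D D' hD hD' hM hN hiso hirr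
  exact hV W W' u D D' hD hD' hM hN hu

end CovolumeEngine

end Summit.BirchSwinnertonDyer.Rank1Residual.ManinAdditive

end
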